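import Literature.Topology.FourManifolds.StabilisationCobordism
import HarnessLib

/-!
# The stabilisation cobordism with its lattice data — the Kronecker law for the core

Topic `Literature/Topology/FourManifolds`; fact seat of
`Literature.Topology.FourManifolds.isHCobordant_of_equivalent_intersectionForm` (Wall 1964,
Thm. 2), step O3 of the ODD programme of Wall's trick (`HCobordismWallTrickEven.lean`).

`StabilisationCobordism.exists_stabilisationCobordism` gives, for a `k`-fold stabilisation `P` of
`X`, the cobordism `E : X ∼ P` of the trivially attached 2-handles with its lattice data, among
which the law "(P2) a class `x ∈ H₂(P)` orthogonal to all `βⱼ` comes from `X`: `inr_* x = inl_* w`".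
For a core `X` whose classes do NOT all die in the filling behind it (the twisted summand of the
odd programme) one needs to know WHICH `w`: this file re-runs the same induction with the sharper
law **(P2K) `inr_* x = inl_* w` and `⟨Θ (c, 0), x⟩ = ⟨c, w⟩` for every `c ∈ H²(X)/T`** — the
witness is the collapse of `x` to `X`, and `Θ (·, 0)` is the pull-back along the collapse maps, so
the law is the naturality of the Kronecker pairing (`freeKroneckerPairing_map_collapseLeft_map_jAC`,
`…_jBC`; base case: the two ends of the cylinder are homotopic).  Nothing else changes; the
original statement is untouched (its users are many).

* `base_data_kronecker`, `step_kronecker` — base and step with the Kronecker law;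
* `exists_stabilisationCobordism_kronecker` — the `k`-fold data with (P2K).

Everything is proved; no named fact and no definition is introduced.

## References

* R. C. Kirby, *The topology of 4-manifolds*, LNM 1374 (1989), Ch. X, proof of Thm. 1
  (pp. 55–56). [Kirby1989]
* C. T. C. Wall, *On simply-connected 4-manifolds*, J. London Math. Soc. 39 (1964) 141–149, §2
  pp. 145–146. [WallJLMS1964]
* A. Hatcher, *Algebraic Topology*, CUP (2002), §2.2, §3.1 (naturality of the Kronecker pairing).
  [HatcherAT2002]
-/

noncomputable section

open scoped Manifold ContDiff Topology ContinuousMap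
open Set Function Metric Topology CategoryTheory CategoryTheory.Limits
open Literature.AlgebraicTopology.SingularHomology Literature.AlgebraicTopology.Homotopy

namespace Literature.Topology.FourManifolds

/-- Local notation: `𝔼 n` is the model Euclidean space `EuclideanSpace ℝ (Fin n)`. -/
local notation "𝔼 " n:arg => EuclideanSpace ℝ (Fin n)

/-- Local notation: `𝕊 n` is the unit sphere in `EuclideanSpace ℝ (Fin (n + 1))`. -/
local notation "𝕊 " n:arg => (Metric.sphere (0 : EuclideanSpace ℝ (Fin (n + 1))) 1)

/-- Local notation: `Q⟦μ⟧` is the intersection form on `H²(·; ℤ)/T`. -/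
local notation "Q⟦" μ "⟧" =>
  Literature.AlgebraicTopology.SingularHomology.intersectionForm two_add_two_eq_four μ

/-! ### The step with the Kronecker law -/

section Step

variable {X M' P : Type} [TopologicalSpace X] [TopologicalSpace M'] [T2Space M']
  [ChartedSpace (𝔼 4) M'] [CompactSpace M'] [TopologicalSpace P] [T2Space P]
  [ChartedSpace (𝔼 4) X] [ChartedSpace (𝔼 4) P]

variable (d : ConnectedSumNeck 4 M' ((𝕊 2) × (𝕊 2)) P)

set_option maxHeartbeats 800000 in
/-- **The homological bookkeeping of one stabilisation step, law (P2K)**: as (P2) of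
`step_homology` — a class of `P = M' # S² × S²` orthogonal to all `βⱼ` comes from `X` through the
composite `E = E' ∪ E₁` — together with the Kronecker law `⟨c_{M'}^* (θ' c), x⟩ = ⟨c, w⟩` for the
witness `w`, GIVEN the same law for `E'` (`hP2'`, any function `θ'`).  Proof: that of (P2)
(Mayer–Vietoris along the neck, the belt sphere dies, the cylinder law), plus the naturality of the
Kronecker pairing under the collapse maps. [cite: Kirby1989, Ch. X, proof of Thm. 1, pp. 55–56]
[cite: HatcherAT2002, §3.1] -/
theorem step_kronecker {k : ℕ} (E' : Cobordism 4 X M') (E₁ : Cobordism 4 M' P) (E : Cobordism 4 X P)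
    (e₁ : C(E'.W, E.W)) (e₂ : C(E₁.W, E.W))
    (hseam : ∀ y, e₁ (E'.inr y) = e₂ (E₁.inl y)) (hinr : ∀ p, E.inr p = e₂ (E₁.inr p))
    (hinl : (⟨E.inl, E.continuous_inl⟩ : C(X, E.W)).Homotopic (e₁.comp ⟨E'.inl, E'.continuous_inl⟩))
    (s : C(𝕊 2, ↥(puncture d.i₂))) (p₀ : 𝕊 2)
    (hs : ∀ v, ((s v : ↥(puncture d.i₂)) : (𝕊 2) × (𝕊 2)) = (p₀, v))
    (hcyl : ∀ j, singularHomology.map ℤ ℤ ((⟨E₁.inr, E₁.continuous_inr⟩ : C(P, E₁.W)).comp d.jAC) j =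
      singularHomology.map ℤ ℤ ((⟨E₁.inl, E₁.continuous_inl⟩ : C(M', E₁.W)).comp
        (HomologicalOrientation.valC (puncture d.i₁))) j)
    (hbelt : singularHomology.map ℤ ℤ ((⟨E₁.inr, E₁.continuous_inr⟩ : C(P, E₁.W)).comp
      (d.jBC.comp s)) 2 = 0)
    (β' : Fin k → freeCohomology ℤ M' 2) (μS' : HomologicalOrientation ℤ ((𝕊 2) × (𝕊 2)) 4)
    (θ' : ↥(freeCohomology ℤ X 2) → ↥(freeCohomology ℤ M' 2))
    (hP2' : ∀ x : singularHomology ℤ ℤ M' 2, (∀ j, freeKroneckerPairing M' 2 (β' j) x = 0) →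
      ∃ w : singularHomology ℤ ℤ X 2,
        singularHomology.map ℤ ℤ (⟨E'.inr, E'.continuous_inr⟩ : C(M', E'.W)) 2 x =
          singularHomology.map ℤ ℤ (⟨E'.inl, E'.continuous_inl⟩ : C(X, E'.W)) 2 w ∧
        ∀ c, freeKroneckerPairing M' 2 (θ' c) x = freeKroneckerPairing X 2 c w)
    (Φ : (↥(freeCohomology ℤ M' 2) × ↥(freeCohomology ℤ ((𝕊 2) × (𝕊 2)) 2)) ≃+ ↥(freeCohomology ℤ P 2))
    (hΦapply : ∀ ac, Φ ac = freeCohomology.map d.collapseLeft 2 ac.1 +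
      freeCohomology.map d.collapseRight 2 ac.2)
    (β : Fin (k + 1) → freeCohomology ℤ P 2)
    (hβ0 : β 0 = Φ (0, SphereProd.hyperbolicIsometryEquiv μS' (Pi.single 0 1)))
    (hβs : ∀ i, β i.succ = Φ (β' i, 0)) :
    ∀ x : singularHomology ℤ ℤ P 2, (∀ j, freeKroneckerPairing P 2 (β j) x = 0) →
      ∃ w : singularHomology ℤ ℤ X 2,
        singularHomology.map ℤ ℤ (⟨E.inr, E.continuous_inr⟩ : C(P, E.W)) 2 x =
          singularHomology.map ℤ ℤ (⟨E.inl, E.continuous_inl⟩ : C(X, E.W)) 2 w ∧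
        ∀ c, freeKroneckerPairing P 2 (Φ (θ' c, 0)) x = freeKroneckerPairing X 2 c w := by
  classical
  letI : ChartedSpace (𝔼 4) ((𝕊 2) × (𝕊 2)) := SphereProd.chartedSpace 2
  set inrE : C(P, E.W) := ⟨E.inr, E.continuous_inr⟩ with hinrE_def
  set inlE : C(X, E.W) := ⟨E.inl, E.continuous_inl⟩ with hinlE_def
  set inr₁ : C(P, E₁.W) := ⟨E₁.inr, E₁.continuous_inr⟩ with hinr₁_def
  set inl₁ : C(M', E₁.W) := ⟨E₁.inl, E₁.continuous_inl⟩ with hinl₁_def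
  set inr' : C(M', E'.W) := ⟨E'.inr, E'.continuous_inr⟩ with hinr'_def
  set inl' : C(X, E'.W) := ⟨E'.inl, E'.continuous_inl⟩ with hinl'_def
  -- filling the punctures
  obtain ⟨vA, hvA_def⟩ : ∃ vA : singularHomology ℤ ℤ ↥(puncture d.i₁) 2 ⟶ singularHomology ℤ ℤ M' 2,
      vA = singularHomology.map ℤ ℤ (HomologicalOrientation.valC (puncture d.i₁)) 2 := ⟨_, rfl⟩
  obtain ⟨vB, hvB_def⟩ : ∃ vB : singularHomology ℤ ℤ ↥(puncture d.i₂) 2 ⟶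
      singularHomology ℤ ℤ ((𝕊 2) × (𝕊 2)) 2,
      vB = singularHomology.map ℤ ℤ (HomologicalOrientation.valC (puncture d.i₂)) 2 := ⟨_, rfl⟩
  haveI hvAiso : IsIso vA := by rw [hvA_def]; exact isIso_map_valC_puncture d.i₁
  haveI hvBiso : IsIso vB := by rw [hvB_def]; exact isIso_map_valC_puncture d.i₂
  have hvA : ∀ z, vA (inv vA z) = z := fun z => by
    rw [← ModuleCat.comp_apply, IsIso.inv_hom_id, ModuleCat.id_apply]
  have hvBinj : Function.Injective vB :=
    ((ConcreteCategory.isIso_iff_bijective vB).1 inferInstance).1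
  -- the fibre sphere of the new summand and its class
  obtain ⟨σS, hσS⟩ : ∃ σS : singularHomology ℤ ℤ (𝕊 2) 2,
      σS = (SphereProd.μS (k := 2) le_rfl).fundamentalClass := ⟨_, rfl⟩
  have hslice : (HomologicalOrientation.valC (puncture d.i₂)).comp s =
      (⟨fun v => (p₀, v), by fun_prop⟩ : C(𝕊 2, (𝕊 2) × (𝕊 2))) := by
    ext v <;> simp [hs v]
  have hy1 : vB (singularHomology.map ℤ ℤ s 2 σS) = SphereProd.y (k := 2) le_rfl 1 := by
    rw [hvB_def, ← ModuleCat.comp_apply, ← singularHomology.map_comp, hslice, hσS]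
    exact SphereProd.map_vertSlice_fundamentalClass p₀
  -- map identities from the composite
  have hinrE : inrE = e₂.comp inr₁ := by ext p; exact hinr p
  have hseamE : e₁.comp inr' = e₂.comp inl₁ := by ext y; exact hseam y
  have hinlE : ∀ w, singularHomology.map ℤ ℤ inlE 2 w =
      singularHomology.map ℤ ℤ e₁ 2 (singularHomology.map ℤ ℤ inl' 2 w) := fun w => by
    rw [singularHomology.map_eq_of_homotopic ℤ ℤ hinl 2, singularHomology.map_comp,
      ModuleCat.comp_apply]
  -- pushing the two pieces of `P` into `E`
  have hA : ∀ y, singularHomology.map ℤ ℤ inrE 2 (singularHomology.map ℤ ℤ d.jAC 2 y) =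
      singularHomology.map ℤ ℤ e₁ 2 (singularHomology.map ℤ ℤ inr' 2 (vA y)) := fun y => by
    have h1 : singularHomology.map ℤ ℤ inrE 2 (singularHomology.map ℤ ℤ d.jAC 2 y) =
        singularHomology.map ℤ ℤ e₂ 2 (singularHomology.map ℤ ℤ (inr₁.comp d.jAC) 2 y) := by
      rw [hinrE, singularHomology.map_comp, singularHomology.map_comp, ModuleCat.comp_apply,
        ModuleCat.comp_apply]
    have h2 : singularHomology.map ℤ ℤ e₂ 2 (singularHomology.map ℤ ℤ
        (inl₁.comp (HomologicalOrientation.valC (puncture d.i₁))) 2 y) =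
        singularHomology.map ℤ ℤ (e₂.comp inl₁) 2 (vA y) := by
      rw [hvA_def, singularHomology.map_comp, singularHomology.map_comp, ModuleCat.comp_apply,
        ModuleCat.comp_apply]
    rw [h1, hcyl 2, h2, ← hseamE, singularHomology.map_comp, ModuleCat.comp_apply]
  have hB : singularHomology.map ℤ ℤ inrE 2
      (singularHomology.map ℤ ℤ d.jBC 2 (singularHomology.map ℤ ℤ s 2 σS)) = 0 := by
    have h3 : singularHomology.map ℤ ℤ inr₁ 2
        (singularHomology.map ℤ ℤ d.jBC 2 (singularHomology.map ℤ ℤ s 2 σS)) =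
        singularHomology.map ℤ ℤ (inr₁.comp (d.jBC.comp s)) 2 σS := by
      rw [singularHomology.map_comp, singularHomology.map_comp]
      rfl
    rw [hinrE, singularHomology.map_comp, ModuleCat.comp_apply, h3, hbelt]
    simp
  intro x hx
  obtain ⟨yA, zB, rfl⟩ := d.exists_eq_map_jAC_add_map_jBC x
  -- the new condition: `zB` is a multiple of the belt sphere
  have h0 : freeKroneckerPairing ((𝕊 2) × (𝕊 2)) 2 (SphereProd.gBasis 0) (vB zB) = 0 := by
    have h := hx 0
    rw [hβ0, hΦapply, map_zero, zero_add, SphereProd.hyperbolicIsometryEquiv_single_zero, map_add,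
      d.freeKroneckerPairing_map_collapseRight_map_jAC two_ne_zero,
      d.freeKroneckerPairing_map_collapseRight_map_jBC, zero_add, ← hvB_def] at h
    exact h
  have hzB' := SphereProd.eq_smul_y_one_of_freeKroneckerPairing_gBasis_zero _ h0
  have hzB : zB = freeKroneckerPairing ((𝕊 2) × (𝕊 2)) 2 (SphereProd.gBasis 1) (vB zB) •
      singularHomology.map ℤ ℤ s 2 σS := by
    apply hvBinj
    rw [map_zsmul, hy1]
    exact hzB'
  -- the old conditions
  have hold : ∀ i, freeKroneckerPairing M' 2 (β' i) (vA yA) = 0 := fun i => by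
    have hi := hx i.succ
    rw [hβs, hΦapply, map_zero, add_zero, map_add,
      d.freeKroneckerPairing_map_collapseLeft_map_jAC,
      d.freeKroneckerPairing_map_collapseLeft_map_jBC two_ne_zero, add_zero, ← hvA_def] at hi
    exact hi
  obtain ⟨w, hw, hwK⟩ := hP2' (vA yA) hold
  refine ⟨w, ?_, fun c => ?_⟩
  · have hzE : singularHomology.map ℤ ℤ inrE 2 (singularHomology.map ℤ ℤ d.jBC 2 zB) = 0 := by
      rw [hzB, map_zsmul, map_zsmul, hB, zsmul_zero]
    rw [map_add, hA, hw, hzE, add_zero, hinlE]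
  · -- the Kronecker law: `⟨c_{M'}^* (θ' c), jA yA + jB zB⟩ = ⟨θ' c, vA yA⟩ = ⟨c, w⟩`
    rw [hΦapply, map_zero, add_zero, map_add,
      d.freeKroneckerPairing_map_collapseLeft_map_jAC,
      d.freeKroneckerPairing_map_collapseLeft_map_jBC two_ne_zero, add_zero, ← hvA_def]
    exact hwK c

end Step

/-! ### The base with the Kronecker law -/

section Form

variable {X P : Type} [TopologicalSpace X] [TopologicalSpace P]
  [T2Space X] [SecondCountableTopology X] [ChartedSpace (𝔼 4) X] [CompactSpace X]
  [IsManifold (𝓡 4) ∞ X] [SimplyConnectedSpace X] [T2Space P] [ChartedSpace (𝔼 4) P]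
  [IsManifold (𝓡 4) ∞ P]

/-- **The base of the induction with the Kronecker law**: as `base_data`, with the witness
`w = (φ⁻¹)_* x` — `inr_* x = inl_* w` because the two ends of the cylinder are homotopic maps
(`Cylinder.sliceHomotopy`), and `⟨(φ⁻¹)^* c, x⟩ = ⟨c, (φ⁻¹)_* x⟩`.
[cite: Kirby1989, Ch. X, proof of Thm. 1, p. 55] [cite: HatcherAT2002, §3.1] -/
theorem base_data_kronecker (φ : X ≃ₘ⟮𝓡 4, 𝓡 4⟯ P) (μX : HomologicalOrientation ℤ X 4)
    (μP : HomologicalOrientation ℤ P 4) :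
    ∃ (E : Cobordism 4 X P) (Θ₀ : ↥(freeCohomology ℤ X 2) ≃+ ↥(freeCohomology ℤ P 2))
      (μX' : HomologicalOrientation ℤ X 4),
      SimplyConnectedSpace E.W ∧
      Epi (singularHomology.map ℤ ℤ (⟨E.inr, E.continuous_inr⟩ : C(P, E.W)) 2) ∧
      (μX' = μX ∨ μX' = -μX) ∧
      (∀ x : singularHomology ℤ ℤ P 2, ∃ w : singularHomology ℤ ℤ X 2,
        singularHomology.map ℤ ℤ (⟨E.inr, E.continuous_inr⟩ : C(P, E.W)) 2 x =
          singularHomology.map ℤ ℤ (⟨E.inl, E.continuous_inl⟩ : C(X, E.W)) 2 w ∧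
        ∀ c, freeKroneckerPairing P 2 (Θ₀ c) x = freeKroneckerPairing X 2 c w) ∧
      (∀ x y, Q⟦μP⟧ (Θ₀ x) (Θ₀ y) = Q⟦μX'⟧ x y) := by
  haveI : CompactSpace P := φ.toHomeomorph.compactSpace
  haveI : ConnectedSpace X := inferInstance
  haveI : SimplyConnectedSpace P := φ.toHomeomorph.symm.toHomotopyEquiv.simplyConnectedSpace
  -- the cylinder, re-ended by `φ`
  let C : Cobordism 4 X X := cylinderCobordism 4 X
  let E : Cobordism 4 X P := C.compDiffeomorphRight φ.symm
  -- the ends of the cylinder are homology isomorphisms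
  haveI h0 : IsIso (singularHomology.map ℤ ℤ (⟨C.inl, C.continuous_inl⟩ : C(X, C.W)) 2) :=
    (singularHomology.isoOfHomotopyEquiv ℤ ℤ
      (Cylinder.sliceHomotopyEquiv (M := X) 0 ⟨le_rfl, zero_le_one⟩) 2).isIso_hom
  haveI h1 : IsIso (singularHomology.map ℤ ℤ (⟨C.inr, C.continuous_inr⟩ : C(X, C.W)) 2) :=
    (singularHomology.isoOfHomotopyEquiv ℤ ℤ
      (Cylinder.sliceHomotopyEquiv (M := X) 1 ⟨zero_le_one, le_rfl⟩) 2).isIso_hom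
  haveI hφ : IsIso (singularHomology.map ℤ ℤ (φ.symm.toHomeomorph : C(P, X)) 2) :=
    (singularHomology.mapIso ℤ ℤ φ.symm.toHomeomorph 2).isIso_hom
  -- the orientation making `φ⁻¹` of degree one
  obtain ⟨μX', hμX', hdeg⟩ := exists_hasDegree_one_of_homeomorph μP μX φ.symm.toHomeomorph
  refine ⟨E, (freeCohomology.mapEquiv (R := ℤ) φ.symm.toHomeomorph 2).toAddEquiv, μX', ?_, ?_,
    hμX', fun x => ?_, fun x y => ?_⟩
  · -- the cylinder is simply connected
    show SimplyConnectedSpace ↥(Cylinder.carrier X)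
    exact (Cylinder.sliceHomotopyEquiv (M := X) 0 ⟨le_rfl, zero_le_one⟩).symm.simplyConnectedSpace
  · change Epi (singularHomology.map ℤ ℤ
      ((⟨C.inr, C.continuous_inr⟩ : C(X, C.W)).comp (φ.symm.toHomeomorph : C(P, X))) 2)
    rw [singularHomology.map_comp]
    infer_instance
  · -- `w = (φ⁻¹)_* x`: the two ends of the cylinder are homotopic maps
    refine ⟨singularHomology.map ℤ ℤ (φ.symm.toHomeomorph : C(P, X)) 2 x, ?_, fun c => ?_⟩
    · have hslices : (⟨C.inl, C.continuous_inl⟩ : C(X, C.W)).Homotopic ⟨C.inr, C.continuous_inr⟩ := by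
        have h0' : (⟨C.inl, C.continuous_inl⟩ : C(X, C.W)) =
            ((Cylinder.sliceEndCM (M := X) 0 ⟨le_rfl, zero_le_one⟩).comp Cylinder.proj).comp
              (Cylinder.sliceEndCM (M := X) 1 ⟨zero_le_one, le_rfl⟩) := by
          ext x : 1
          rfl
        have h1' : (⟨C.inr, C.continuous_inr⟩ : C(X, C.W)) =
            (ContinuousMap.id _).comp (Cylinder.sliceEndCM (M := X) 1 ⟨zero_le_one, le_rfl⟩) := by
          ext x : 1
          rfl
        rw [h0', h1']
        exact ContinuousMap.Homotopic.comp
          (⟨Cylinder.sliceHomotopy 0 ⟨le_rfl, zero_le_one⟩⟩ : ContinuousMap.Homotopic _ _)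
          (ContinuousMap.Homotopic.refl _)
      change singularHomology.map ℤ ℤ
          ((⟨C.inr, C.continuous_inr⟩ : C(X, C.W)).comp (φ.symm.toHomeomorph : C(P, X))) 2 x = _
      rw [singularHomology.map_comp, ModuleCat.comp_apply, ← singularHomology.map_eq_of_homotopic ℤ ℤ hslices 2]
      rfl
    · exact freeKroneckerPairing_map (φ.symm.toHomeomorph : C(P, X)) c x
  · change Q⟦μP⟧ (freeCohomology.map (R := ℤ) (φ.symm.toHomeomorph : C(P, X)) 2 x)
        (freeCohomology.map (R := ℤ) (φ.symm.toHomeomorph : C(P, X)) 2 y) = _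
    rw [intersectionForm_map_map two_add_two_eq_four μP μX' hdeg, one_mul]

end Form

/-! ### The `k`-fold data with the Kronecker law -/

section Assembly

set_option maxHeartbeats 800000 in
/-- **The cobordism of `k` trivially attached 2-handles with its lattice data and the Kronecker
law (P2K)** — `exists_stabilisationCobordism` verbatim with (P2) sharpened to: a class `x ∈ H₂(P)`
orthogonal to all `βⱼ` satisfies `inr_* x = inl_* w` for a `w ∈ H₂(X)` with
`⟨Θ (c, 0), x⟩ = ⟨c, w⟩` for every `c ∈ H²(X)/T`.  Same induction (`step_homology` for (P1), (P3),
`step_kronecker` for (P2K), `step_form` for (P4), `base_data_kronecker`).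
[cite: Kirby1989, Ch. X, proof of Thm. 1, pp. 55–56] [cite: WallJLMS1964, §2 pp. 145–146] -/
theorem exists_stabilisationCobordism_kronecker (k : ℕ) :
    ∀ (X : Type) [TopologicalSpace X] [T2Space X] [SecondCountableTopology X]
      [ChartedSpace (𝔼 4) X] [CompactSpace X] [IsManifold (𝓡 4) ∞ X] [SimplyConnectedSpace X]
      (P : Type) [TopologicalSpace P] [T2Space P] [ChartedSpace (𝔼 4) P] [IsManifold (𝓡 4) ∞ P],
      IsStabilization k X P →
      SimplyConnectedSpace P ∧ CompactSpace P ∧ SecondCountableTopology P ∧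
      ∀ (μX : HomologicalOrientation ℤ X 4) (μP : HomologicalOrientation ℤ P 4),
        ∃ (E : Cobordism 4 X P) (b : Fin k → singularHomology ℤ ℤ P 2)
          (Θ : (↥(freeCohomology ℤ X 2) × (Fin k → Fin 2 → ℤ)) ≃+ ↥(freeCohomology ℤ P 2))
          (ε : Fin k → ℤ) (μX' : HomologicalOrientation ℤ X 4),
          SimplyConnectedSpace E.W ∧
          Epi (singularHomology.map ℤ ℤ (⟨E.inr, E.continuous_inr⟩ : C(P, E.W)) 2) ∧
          (μX' = μX ∨ μX' = -μX) ∧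
          (∀ j, ε j * ε j = 1) ∧
          (∀ j, singularHomology.map ℤ ℤ (⟨E.inr, E.continuous_inr⟩ : C(P, E.W)) 2 (b j) = 0) ∧
          (∀ x : singularHomology ℤ ℤ P 2,
            (∀ j, freeKroneckerPairing P 2 (Θ (0, Pi.single j (Pi.single 0 1))) x = 0) →
            ∃ w : singularHomology ℤ ℤ X 2,
              singularHomology.map ℤ ℤ (⟨E.inr, E.continuous_inr⟩ : C(P, E.W)) 2 x =
                singularHomology.map ℤ ℤ (⟨E.inl, E.continuous_inl⟩ : C(X, E.W)) 2 w ∧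
              ∀ c, freeKroneckerPairing P 2 (Θ (c, 0)) x = freeKroneckerPairing X 2 c w) ∧
          (∀ (γ : freeCohomology ℤ P 2) (l : Fin k),
            freeKroneckerPairing P 2 γ (b l) =
              ε l * Q⟦μP⟧ γ (Θ (0, Pi.single l (Pi.single 0 1)))) ∧
          (∀ x y, Q⟦μP⟧ (Θ x) (Θ y) = Q⟦μX'⟧ x.1 y.1 + ∑ j, hyperbolicForm (x.2 j) (y.2 j)) := by
  induction k with
  | zero =>
    intro X _ _ _ _ _ _ _ P _ _ _ _ hst
    obtain ⟨φ⟩ := (isStabilization_zero_iff X P).1 hst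
    haveI : CompactSpace P := φ.toHomeomorph.compactSpace
    haveI : SecondCountableTopology P := φ.symm.toHomeomorph.secondCountableTopology
    haveI : SimplyConnectedSpace P := φ.toHomeomorph.symm.toHomotopyEquiv.simplyConnectedSpace
    refine ⟨‹_›, ‹_›, ‹_›, fun μX μP => ?_⟩
    obtain ⟨E, Θ₀, μX', hsc, hepi, hμ, hall, hform⟩ := base_data_kronecker φ μX μP
    refine ⟨E, Fin.elim0, (AddEquiv.prodUnique).trans Θ₀, Fin.elim0, μX', hsc, hepi, hμ,
      fun j => j.elim0, fun j => j.elim0,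
      fun x _ => (hall x).imp fun w hw => ⟨hw.1, fun c => hw.2 c⟩, fun γ l => l.elim0, fun x y => ?_⟩
    rw [AddEquiv.trans_apply, AddEquiv.trans_apply, hform, Finset.univ_eq_empty,
      Finset.sum_empty, add_zero]
    rfl
  | succ k ih =>
    intro X _ _ _ _ _ _ _ P _ _ _ _ hst
    obtain ⟨M', _, _, _, _, hst', hcs⟩ := (isStabilization_succ_iff k X P).1 hst
    obtain ⟨hsc', hcpt', hsnd', hdata'⟩ := ih X M' hst'
    haveI := hsc'
    haveI := hcpt'
    haveI := hsnd'
    obtain ⟨E₁, hE₁sc, d, s, hepi₁, hcyl, hs, hbelt, hPsc, hPc, hP2nd⟩ :=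
      exists_stabilisationStep M' P hcs
    refine ⟨hPsc, hPc, hP2nd, fun μX μP => ?_⟩
    haveI := hPsc
    haveI := hPc
    haveI := hP2nd
    letI : ChartedSpace (𝔼 4) ((𝕊 2) × (𝕊 2)) := SphereProd.chartedSpace 2
    haveI : SimplyConnectedSpace ((𝕊 2) × (𝕊 2)) := SphereProd.simplyConnectedSpace le_rfl
    -- orientations, and the form of `P = M' # S² × S²`
    obtain ⟨μM'₀⟩ := isOrientableOver_of_simplyConnectedSpace ℤ M' (n := 4)
    obtain ⟨μS⟩ : IsOrientableOver ℤ ((𝕊 2) × (𝕊 2)) 4 := SphereProd.isOrientableOver le_rfl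
    obtain ⟨μM', μS', -, -, hΦ⟩ := d.exists_addEquiv_intersectionForm_eq (m := 3) (by norm_num)
      le_rfl two_add_two_eq_four μM'₀ μS μP
    have hΦapply : ∀ ac, d.collapseSumAddEquiv (m := 3) (k := 2) (by norm_num) le_rfl
        (by norm_num) (by norm_num) ac =
        freeCohomology.map d.collapseLeft 2 ac.1 + freeCohomology.map d.collapseRight 2 ac.2 :=
      fun ac => rfl
    -- the induction hypothesis for `M'`, oriented by `μM'`
    obtain ⟨E', b', Θ', ε', μX', hE'sc, hepi', hμX', hε', hP1', hP2', hP3', hP4'⟩ := hdata' μX μM'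
    -- the composite `E = E' ∪ E₁`
    obtain ⟨E, e₁, e₂, -, -, hseam, hinr, hinl, hscE, hMV⟩ := Cobordism.exists_composite E' E₁
    haveI : Epi (biprod.desc (singularHomology.map ℤ ℤ e₁ 2) (singularHomology.map ℤ ℤ e₂ 2)) :=
      hMV inferInstance 1 (isZero_singularHomology_one_of_simplyConnectedSpace ℤ ℤ (X := M'))
    -- the identification `Θ` with one more hyperbolic summand, and the classes `βⱼ`
    obtain ⟨Θ, hΘ⟩ := exists_addEquiv_cons Θ'
      (SphereProd.hyperbolicIsometryEquiv μS').toLinearEquiv.toAddEquiv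
      (d.collapseSumAddEquiv (m := 3) (k := 2) (by norm_num) le_rfl (by norm_num) (by norm_num))
    have hβ0 : Θ (0, Pi.single 0 (Pi.single 0 1)) =
        d.collapseSumAddEquiv (m := 3) (k := 2) (by norm_num) le_rfl (by norm_num) (by norm_num)
          (0, SphereProd.hyperbolicIsometryEquiv μS' (Pi.single 0 1)) := by
      rw [hΘ, tail_single_zero, Pi.single_eq_same, Prod.mk_zero_zero, map_zero]
      rfl
    have hβs : ∀ i : Fin k, Θ (0, Pi.single i.succ (Pi.single 0 1)) =
        d.collapseSumAddEquiv (m := 3) (k := 2) (by norm_num) le_rfl (by norm_num) (by norm_num)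
          (Θ' (0, Pi.single i (Pi.single 0 1)), 0) := by
      intro i
      rw [hΘ, tail_single_succ, single_succ_apply_zero, map_zero]
    -- the homological data
    obtain ⟨b, hP1, -, hP3⟩ := step_homology d E' E₁ E e₁ e₂ hseam hinr hinl s _ hs hcyl hbelt
      b' (fun j => Θ' (0, Pi.single j (Pi.single 0 1))) ε' μM' μS' μP hP1'
      (fun x hx => (hP2' x hx).imp fun w hw => hw.1) hP3' _ hΦapply hΦ
      (fun j => Θ (0, Pi.single j (Pi.single 0 1))) hβ0 hβs
    have hP2 := step_kronecker d E' E₁ E e₁ e₂ hseam hinr hinl s _ hs hcyl hbelt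
      (fun j => Θ' (0, Pi.single j (Pi.single 0 1))) μS' (fun c => Θ' (c, 0)) hP2' _ hΦapply
      (fun j => Θ (0, Pi.single j (Pi.single 0 1))) hβ0 hβs
    have hΘc : ∀ c, Θ (c, 0) = d.collapseSumAddEquiv (m := 3) (k := 2) (by norm_num) le_rfl
        (by norm_num) (by norm_num) (Θ' (c, 0), 0) := fun c => by
      rw [hΘ]
      simp only [Pi.zero_apply, map_zero]
      rfl
    refine ⟨E, b, Θ, Fin.cons (Q⟦μS'⟧ (SphereProd.gBasis 0) (SphereProd.gBasis 1)) ε', μX',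
      hscE hE'sc hE₁sc inferInstance,
      epi_map_inr_of_pieces E' E₁ E e₁ e₂ hseam hinr hepi' hepi₁, hμX', ?_, hP1,
      fun x hx => (hP2 x hx).imp fun w hw => ⟨hw.1, fun c => by rw [hΘc]; exact hw.2 c⟩, hP3,
      step_form μX' μM' μS' μP Θ' (SphereProd.hyperbolicIsometryEquiv μS') _ hΦ hP4' Θ hΘ⟩
    refine Fin.cases ?_ (fun i => ?_)
    · rw [Fin.cons_zero]
      exact SphereProd.intersectionForm_gBasis_mul_self μS'
    · rw [Fin.cons_succ]
      exact hε' i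


end Assembly

end Literature.Topology.FourManifolds

end
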